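import Literature.Analysis.ValidatedNumerics.CodeListKrawczykDataCertificate
import HarnessLib

/-!
# Split Krawczyk certificate, SUPPORT-AWARE row obligations (skip the partials along absent variables)

Topic `Literature/Analysis/ValidatedNumerics`.  Sequel of `CodeListKrawczykDataCertificate.lean`: its per-row obligation
`rowOK i` evaluates the natural extension of ALL `n` derived code lists `∂ₖfᵢ` over the box — each one a full traversal of
the row, even when the variable `xₖ` does not occur in `fᵢ` (then `∂ₖfᵢ ≡ 0`).  For sparse systems (the NS item-20428 rows
mention 30–60 of 185 letters) that is the dominant cost (measured: 48 s for a 592-term row, 86–162 s for 1 837 terms at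
`n = 185`).  Here

* `mentions k e : Bool` — the variable `xₖ` occurs in the code list `e` (structural);
* `eval_pderiv_eq_zero_of_not_mentions` — if it does not, the derived code list `∂ₖe` evaluates to `0` everywhere
  (induction over the code list; Moore 1979 §4.3 (4.21) read for an absent argument);
* `CodeListKrawczykDataCert.rowOKs i` — the support-aware obligation: as `rowOK i`, but for `k` not mentioned by `fᵢ` it
  only asks that the supplied `jac i k` contain `0` (no traversal);
* `sound_of_rowOKs`, `existsUnique_zero_of_rowOKs`, `zero_mem_krawczykBox_of_rowOKs` — the same conclusions as the
  parent file (Neumaier Thm 5.1.8 via `KrawczykTest_holds`), the supplied `[J]` again a Lipschitz matrix for `f` on `X`.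

Sources: R. E. Moore, *Methods and Applications of Interval Analysis* (SIAM 1979) §4.3 (4.21), §5.2 Thms 5.3–5.4 [Moore1979];
A. Neumaier, *Interval Methods for Systems of Equations* (CUP 1990) Thm 5.1.8, Cor. 5.1.5 [Neumaier1991].  Generic; no NS content.
AI-produced formalisation (H21, seat ns-k2-port-2 g2, 2026-08-28).
-/

set_option autoImplicit false

noncomputable section

open Set NonemptyInterval Matrix
open Literature.Analysis.ODE Literature.Analysis.ODE.FExpr
open Literature.Analysis.ValidatedNumerics.ITaylor

namespace Literature.Analysis.ValidatedNumerics

variable {n : ℕ}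

/-! ### Variables mentioned by a code list -/

/-- `mentions k e`: the variable `xₖ` occurs in the code list `e`. [cite: Moore1979, §3.4 (code lists)] -/
def mentions (k : Fin n) : FExpr n → Bool
  | .var i => decide (i = k)
  | .const _ => false
  | .add a b => mentions k a || mentions k b
  | .sub a b => mentions k a || mentions k b
  | .neg a => mentions k a
  | .smul _ a => mentions k a
  | .mul a b => mentions k a || mentions k b
  | .pow a _ => mentions k a
  | .exp a => mentions k a
  | .log a => mentions k a
  | .sin a => mentions k a
  | .cos a => mentions k a
  | .inv a => mentions k a
  | .div a b => mentions k a || mentions k b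
  | .sqrt a => mentions k a

/-- **A derived code list along an absent variable evaluates to zero** everywhere.
[cite: Moore1979, §4.3 eq. (4.21)] -/
theorem eval_pderiv_eq_zero_of_not_mentions (k : Fin n) :
    ∀ (e : FExpr n), mentions k e = false → ∀ x : Fin n → ℝ, (e.pderiv k).eval x = 0
  | .var i, h, x => by
      simp only [mentions, decide_eq_false_iff_not] at h
      simp [FExpr.pderiv, FExpr.eval, h]
  | .const _, _, x => by simp [FExpr.pderiv, FExpr.eval]
  | .add a b, h, x => by
      simp only [mentions, Bool.or_eq_false_iff] at h
      simp [FExpr.pderiv, FExpr.eval, eval_pderiv_eq_zero_of_not_mentions k a h.1 x,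
        eval_pderiv_eq_zero_of_not_mentions k b h.2 x]
  | .sub a b, h, x => by
      simp only [mentions, Bool.or_eq_false_iff] at h
      simp [FExpr.pderiv, FExpr.eval, eval_pderiv_eq_zero_of_not_mentions k a h.1 x,
        eval_pderiv_eq_zero_of_not_mentions k b h.2 x]
  | .neg a, h, x => by
      simp only [mentions] at h
      simp [FExpr.pderiv, FExpr.eval, eval_pderiv_eq_zero_of_not_mentions k a h x]
  | .smul _ a, h, x => by
      simp only [mentions] at h
      simp [FExpr.pderiv, FExpr.eval, eval_pderiv_eq_zero_of_not_mentions k a h x]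
  | .mul a b, h, x => by
      simp only [mentions, Bool.or_eq_false_iff] at h
      simp [FExpr.pderiv, FExpr.eval, eval_pderiv_eq_zero_of_not_mentions k a h.1 x,
        eval_pderiv_eq_zero_of_not_mentions k b h.2 x]
  | .pow a _, h, x => by
      simp only [mentions] at h
      simp [FExpr.pderiv, FExpr.eval, eval_pderiv_eq_zero_of_not_mentions k a h x]
  | .exp a, h, x => by
      simp only [mentions] at h
      simp [FExpr.pderiv, FExpr.eval, eval_pderiv_eq_zero_of_not_mentions k a h x]
  | .log a, h, x => by
      simp only [mentions] at h
      simp [FExpr.pderiv, FExpr.eval, eval_pderiv_eq_zero_of_not_mentions k a h x]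
  | .sin a, h, x => by
      simp only [mentions] at h
      simp [FExpr.pderiv, FExpr.eval, eval_pderiv_eq_zero_of_not_mentions k a h x]
  | .cos a, h, x => by
      simp only [mentions] at h
      simp [FExpr.pderiv, FExpr.eval, eval_pderiv_eq_zero_of_not_mentions k a h x]
  | .inv a, h, x => by
      simp only [mentions] at h
      simp [FExpr.pderiv, FExpr.eval, eval_pderiv_eq_zero_of_not_mentions k a h x]
  | .div a b, h, x => by
      simp only [mentions, Bool.or_eq_false_iff] at h
      simp [FExpr.pderiv, FExpr.eval, eval_pderiv_eq_zero_of_not_mentions k a h.1 x,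
        eval_pderiv_eq_zero_of_not_mentions k b h.2 x]
  | .sqrt a, h, x => by
      simp only [mentions] at h
      simp [FExpr.pderiv, FExpr.eval, eval_pderiv_eq_zero_of_not_mentions k a h x]

namespace CodeListKrawczykDataCert

variable (c : CodeListKrawczykDataCert n)

/-- Support-aware entry check: the usual containment if `xₖ` occurs in row `i`, else only `0 ∈ jac i k`.
[cite: Moore1979, §4.3 eq. (4.21)] -/
def jacOKs (i k : Fin n) : Bool :=
  if mentions k (c.system i) then c.jacOK i k
  else decide ((c.jac i k).fst ≤ 0) && decide (0 ≤ (c.jac i k).snd)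

/-- **THE SUPPORT-AWARE PER-ROW OBLIGATION** (no traversal for absent variables). [cite: Moore1979, §4.3 eq. (4.21)] -/
def rowOKs (i : Fin n) : Bool :=
  (c.valOpt i).isSome && (c.rangeOpt i).isSome && (List.finRange n).all fun k => c.jacOKs i k

/-- Unpacking a support-aware certified row. [cite: Moore1979, §4.3 eq. (4.21)] -/
theorem rowOKs_spec {i : Fin n} (h : c.rowOKs i = true) (k : Fin n) :
    c.valOpt i = some (c.valBox i) ∧ (c.rangeOpt i).isSome = true ∧ c.jacOKs i k = true := by
  simp only [rowOKs, Bool.and_eq_true] at h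
  obtain ⟨⟨h1, h2⟩, h3⟩ := h
  refine ⟨?_, h2, List.all_eq_true.1 h3 k (List.mem_finRange k)⟩
  cases hv : c.valOpt i with
  | none => rw [hv] at h1; exact absurd h1 (by simp)
  | some I => simp [valBox, hv]

/-- The box lies in the natural domain of the system. [cite: Moore1979, §3.4 (last paragraph)] -/
theorem box_subset_dom_of_rowOKs (hr : ∀ i, c.rowOKs i = true) : boxSet (castBox c.box) ⊆ domOpens c.system := by
  intro y hy
  rw [SetLike.mem_coe, mem_domOpens]
  intro i
  obtain ⟨I, hI⟩ := Option.isSome_iff_exists.1 (c.rowOKs_spec (hr i) i).2.1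
  exact (evalBox_sound hI hy).1

/-- `f(x̃) ∈ F([x̃, x̃])`. [cite: Moore1979, §5.2 eq. (5.6) (the term f(y))] -/
theorem value_mem_valBox_of_rowOKs (hr : ∀ i, c.rowOKs i = true) (i : Fin n) :
    fieldFun c.system (fun l => (c.center l : ℝ)) i ∈ (c.valBox i).ratCast ℝ :=
  (evalBox_sound (c.rowOKs_spec (hr i) i).1 (ratVec_mem_pointBox c.center)).2

/-- **The supplied interval Jacobian encloses the Jacobian** (present variables: natural extension; absent ones: the
partial is `0 ∈ jac i k`). [cite: Moore1979, §4.3 eq. (4.21)] [cite: Neumaier1991, Prop. 5.1.4] -/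
theorem fderiv_apply_mem_jac_of_rowOKs (hr : ∀ i, c.rowOKs i = true) {y : Fin n → ℝ}
    (hy : y ∈ boxSet (castBox c.box)) (i k : Fin n) :
    fderiv ℝ (fieldFun c.system) y (Pi.single k 1) i ∈ castMat c.jac i k := by
  have hk := (c.rowOKs_spec (hr i) k).2.2
  rw [castMat_apply, fderiv_fieldFun_apply_single c.system (c.box_subset_dom_of_rowOKs hr hy) i k, mem_ratCast_iff]
  unfold jacOKs at hk
  by_cases hm : mentions k (c.system i) = true
  · rw [if_pos hm] at hk
    unfold jacOK at hk
    cases hI : c.jacOpt i k with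
    | none => rw [hI] at hk; exact absurd hk (by simp)
    | some I =>
      rw [hI] at hk
      simp only [Bool.and_eq_true, decide_eq_true_eq] at hk
      have h := (evalBox_sound hI hy).2
      rw [mem_ratCast_iff] at h
      exact ⟨le_trans (by exact_mod_cast hk.1) h.1, le_trans h.2 (by exact_mod_cast hk.2)⟩
  · have hm' : mentions k (c.system i) = false := by simpa using hm
    rw [if_neg hm] at hk
    simp only [Bool.and_eq_true, decide_eq_true_eq] at hk
    rw [eval_pderiv_eq_zero_of_not_mentions k _ hm' y]
    exact ⟨by exact_mod_cast hk.1, by exact_mod_cast hk.2⟩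

/-- The system is differentiable at every point of the box. [cite: Moore1979, §3.4 (last paragraph)] -/
theorem hasFDerivAt_fieldFun_of_rowOKs (hr : ∀ i, c.rowOKs i = true) {y : Fin n → ℝ}
    (hy : y ∈ boxSet (castBox c.box)) :
    HasFDerivAt (fieldFun c.system) (fderiv ℝ (fieldFun c.system) y) y :=
  have hyΩ := c.box_subset_dom_of_rowOKs hr hy
  ((((contDiffOn_fieldFun c.system).differentiableOn (by simp)) y hyΩ).differentiableAt
    ((domOpens c.system).isOpen.mem_nhds hyΩ)).hasFDerivAt

/-- **The supplied interval Jacobian is a Lipschitz matrix for `f` on `X`.** [cite: Neumaier1991, Cor. 5.1.5] -/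
theorem isLipschitzSetOn_lipMat_of_rowOKs (hr : ∀ i, c.rowOKs i = true) :
    IsLipschitzSetOn c.lipMat (fieldFun c.system) (boxSet (castBox c.box)) :=
  isLipschitzSetOn_matrixIcc_of_hasFDerivWithinAt (convex_boxSet _)
    (fun y hy => (c.hasFDerivAt_fieldFun_of_rowOKs hr hy).hasFDerivWithinAt)
    fun y hy i k => by
      have h := c.fderiv_apply_mem_jac_of_rowOKs hr hy i k
      rw [castMat_apply, mem_ratCast_iff] at h
      exact h

/-- The cast of the negated preconditioner. [folklore] -/
private theorem castQMat_neg''' (C : Matrix (Fin n) (Fin n) ℚ) : castQMat (-C) = -castQMat C := by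
  ext i l
  simp only [castQMat_apply, Matrix.neg_apply, Rat.cast_neg]

/-- The computed Krawczyk box encloses the Krawczyk set (support-aware hypotheses). [cite: Neumaier1991, §3.1 Proposition 3.1.2 (6)]
[cite: Moore1979, §5.2 eq. (5.6)] -/
theorem kSet_subset_krawczykBox_of_rowOKs (hr : ∀ i, c.rowOKs i = true) : c.kSet ⊆ boxSet (castBox c.krawczykBox) := by
  intro z hz
  rw [mem_boxSet_iff]
  intro i
  obtain ⟨B, hB, y, hy, hzi⟩ := hz i
  have hp : (fun l => (c.center l : ℝ)) - castQMat c.precond *ᵥ fieldFun c.system (fun l => (c.center l : ℝ))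
      ∈ boxSet (castBox c.residualBox) := by
    rw [mem_boxSet_iff]
    intro j
    rw [sub_eq_add_neg, ← Matrix.neg_mulVec, ← castQMat_neg''']
    simp only [castBox_apply, residualBox, QMvPoly.ratCast_add, ratCast_pure, Pi.add_apply]
    refine add_mem_add' (mem_pure_self _) ?_
    have h := mulVec_mem_imatvecQ (fun a b => castQMat_mem_pointMat (-c.precond) a b)
      (fun l => by rw [castBox_apply]; exact c.value_mem_valBox_of_rowOKs hr l) j
    rwa [castBox_apply] at h
  have hM : ∀ a b, (1 - B) a b ∈ castMat c.slopeBox a b := by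
    intro a b
    obtain ⟨M, hM, hab⟩ := hB a b
    rw [Matrix.sub_apply, hab, sub_eq_add_neg, ← Matrix.neg_apply, ← Matrix.neg_mul, ← castQMat_neg''',
      castMat_apply]
    simp only [slopeBox, QMvPoly.ratCast_add]
    refine add_mem_add' ?_ ?_
    · have h1 := castQMat_mem_pointMat (1 : Matrix (Fin n) (Fin n) ℚ) a b
      rw [castQMat_one, castMat_apply] at h1
      exact h1
    · have h2 := mul_mem_imatmulQ (fun i k => castQMat_mem_pointMat (-c.precond) i k)
        ((c.mem_lipMat_iff).1 hM) a b
      rwa [castMat_apply] at h2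
  have hmv := meanValue_mem_mvBoxQ (m := c.center) hp hM hy
  have heq : (fun l => (c.center l : ℝ)) - castQMat c.precond *ᵥ fieldFun c.system (fun l => (c.center l : ℝ))
        - (B - 1) *ᵥ (y - fun l => (c.center l : ℝ)) =
      (fun l => (c.center l : ℝ)) - castQMat c.precond *ᵥ fieldFun c.system (fun l => (c.center l : ℝ))
        + (1 - B) *ᵥ (y - fun l => (c.center l : ℝ)) := by
    rw [sub_eq_add_neg (_ - _), ← Matrix.neg_mulVec, neg_sub]
  rw [hzi, heq]
  exact (mem_boxSet_iff.1 hmv) i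

/-- **SOUNDNESS WITH SUPPORT-AWARE ROW OBLIGATIONS.** [cite: Neumaier1991, Thm 5.1.8] [cite: Moore1979, §5.2 Thms 5.3–5.4] -/
theorem sound_of_rowOKs (hr : ∀ i, c.rowOKs i = true) (hc : c.coreCheck = true) :
    (∀ M ∈ c.lipMat, M.det ≠ 0) ∧
    (∃! z, z ∈ boxSet (castBox c.box) ∧ fieldFun c.system z = 0) ∧
    (∀ z ∈ boxSet (castBox c.box), fieldFun c.system z = 0 → z ∈ boxSet (castBox c.krawczykBox)) := by
  have h := KrawczykTest_holds n (fieldFun c.system) (boxSet (castBox c.box))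
    (fun i k => (((c.jac i k).fst : ℚ) : ℝ)) (fun i k => (((c.jac i k).snd : ℚ) : ℝ))
    (castQMat c.precond) (boxLo (castBox c.box)) (boxHi (castBox c.box)) (fun l => (c.center l : ℝ))
    (exists_lipschitzOnWith_of_isLipschitzSetOn (c.isLipschitzSetOn_lipMat_of_rowOKs hr))
    (c.isLipschitzSetOn_lipMat_of_rowOKs hr) (fun _ hy => hy) (c.center_mem_interior hc) (c.kSet_nonempty hc)
    ((c.kSet_subset_krawczykBox_of_rowOKs hr).trans (boxSet_subset_interior_of_strictIn (c.coreCheck_spec hc).2))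
  exact ⟨h.1, h.2.1, fun z hz h0 => c.kSet_subset_krawczykBox_of_rowOKs hr (h.2.2 z hz h0)⟩

/-- **Exactly one solution of the system in the box** (support-aware obligations). [cite: Moore1979, §5.2 Thm 5.4] -/
theorem existsUnique_zero_of_rowOKs (hr : ∀ i, c.rowOKs i = true) (hc : c.coreCheck = true) :
    ∃! z, z ∈ boxSet (castBox c.box) ∧ ∀ i, (c.system i).eval z = 0 := by
  have h := (c.sound_of_rowOKs hr hc).2.1
  simp only [funext_iff] at h
  exact h

/-- **Every solution in the box lies in the Krawczyk box** (support-aware obligations). [cite: Moore1979, §5.2 Thm 5.3] -/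
theorem zero_mem_krawczykBox_of_rowOKs (hr : ∀ i, c.rowOKs i = true) (hc : c.coreCheck = true) {z : Fin n → ℝ}
    (hz : z ∈ boxSet (castBox c.box)) (h0 : ∀ i, (c.system i).eval z = 0) : z ∈ boxSet (castBox c.krawczykBox) :=
  (c.sound_of_rowOKs hr hc).2.2 z hz (funext h0)

end CodeListKrawczykDataCert

/-- Moore's example again: both rows are support-aware certified (all variables present — same work as `rowOK`).
[cite: Moore1979, §5.2 eqs. (5.11)–(5.13)] -/
theorem mooreData_rowOKs (i : Fin 2) : mooreData.rowOKs i = true := by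
  fin_cases i <;> decide +kernel

/-- Exactly one solution of (5.11) in the box, from the support-aware obligations. [cite: Moore1979, §5.2 Thm 5.4] -/
theorem mooreData_existsUnique' :
    ∃! z, z ∈ boxSet (castBox mooreData.box) ∧ ∀ i, (mooreData.system i).eval z = 0 :=
  mooreData.existsUnique_zero_of_rowOKs mooreData_rowOKs mooreData_core

end Literature.Analysis.ValidatedNumerics

end
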